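import Literature.Computability.MetaComplexity.RefutationCNFUpper
import Literature.Computability.MetaComplexity.RefutationCNFLowerBound
import HarnessLib

/-!
# Atserias–Müller, Theorem 2 (a)+(b): discharge of `rrefGadget_hardness`

The named fact `rrefGadget_hardness` of `RefutationCNF.lean` — [Atserias–Müller 2020, Thm 2
(a)+(b)] for the gadget of its proof, `G(F) = RREF(F, 13n²)` — is derived in [AM20, §6] from the
upper bound [AM20, Lemma 11] and the lower bound [AM20, Lemma 10]. All three ingredients are in the
tree: the derivation `rrefGadget_hardness_of_bounds` (`RefutationCNFHardness.lean`), packaged with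
the discharged upper bound as `rrefGadget_hardness_of_lowerBound` (`RefutationCNFUpper.lean`,
from `rrefCNF_upperBound_holds`), and the discharged lower bound `rrefCNF_lowerBound_holds`
(`RefutationCNFLowerBound.lean`). This file only joins the two import branches.

## References

* A. Atserias, M. Müller, *Automating Resolution is NP-hard*, J. ACM 67(5) (2020), Art. 31;
  arXiv:1904.02991: Thm 2, §5 (Lemmas 10, 11), §6 (proof of Thm 2).
-/

namespace Literature.Computability.MetaComplexity

/-- **[Atserias–Müller 2020, Theorem 2 (a)+(b)]** for `G(F) = RREF(F, 13n²)`: discharge of the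
named fact `rrefGadget_hardness`, by the §6 derivation (`rrefGadget_hardness_of_bounds`) from
Lemma 11 (`rrefCNF_upperBound_holds`) and Lemma 10 (`rrefCNF_lowerBound_holds`).
[cite: AtseriasMuller2020, Thm 2 (a)+(b), proof in §6 from Lemmas 10 and 11] -/
theorem rrefGadget_hardness_holds : rrefGadget_hardness :=
  rrefGadget_hardness_of_lowerBound rrefCNF_lowerBound_holds

end Literature.Computability.MetaComplexity
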